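import Literature.NumberTheory.LFunctions.WeilMellinBounds
import Mathlib.MeasureTheory.Measure.Haar.NormedSpace
import HarnessLib

/-!
# The dilation virial of Weil's quadratic functional

Sibling of `Literature/NumberTheory/LFunctions/WeilExplicit.lean` (same normalisation: test functions
`g : ℝ → ℂ` in the additive variable `t = log x`, `ĝ = weilMellin g`, `g̃ = weilReflect g`,
`Q(g) = weilQuadratic g = W(g ⋆ g̃)`). Requested by route `RiemannHypothesis/WeilWindowFlow`
(items `DiniLeakage`, `WindowLipschitz`; idea card `weil-window-flow`): the first-order variation of
`Q` under compression of the window.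

## Bombieri's dilation (E. Bombieri, Rend. Lincei (9) 11 (2000), §4, proof of Theorem 5)

To prove that the bottom `μ^±(M)` of `T[f * f*]` on `L²([M⁻¹, M])` is continuous in `M`, Bombieri
varies a minimiser `f` by
`f_ε(x) = (1+ε)^{1/2} x^{ε/2} f(x^{1+ε})`,
which "is in `L²([M^{-1/(1+ε)}, M^{1/(1+ε)}])`, has norm 1 and has the same parity as `f`", with
`f̃_ε(s) = (1+ε)^{-1/2} f̃((s + ε/2)/(1+ε))`. In the additive variable (`g(t) = e^{t/2} f(e^t)`,
the dictionary of `WeilExplicit.lean`) this is the unitary dilation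
`weilDilate η g (t) = (1+η)^{1/2} g((1+η) t)`:
it preserves `‖g‖₂` (`integral_norm_sq_weilDilate`), maps support `[-a, a]` to
`[-a/(1+η), a/(1+η)]` (`tsupport_weilDilate_subset`), and
`(weilDilate η g)^(s) = (1+η)^{-1/2} ĝ(1/2 + (s - 1/2)/(1+η))` (`weilMellin_weilDilate`).

## The virial

The key bookkeeping identity is that the autocorrelation `k = g ⋆ g̃` of a dilate is the plain
rescaling of `k`, WITHOUT prefactor: `(g_η ⋆ g̃_η)(t) = k((1+η) t)`
(`weilConv_weilDilate_weilReflect`), so `Q(g_η) = W(k((1+η)·))` (`weilQuadratic_weilDilate`).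
Since `W = weilFunctional` is linear and `d/dη|₀ k((1+η)t) = t k'(t)`, the derivative
`d/dη|₀ Q(g_η)` is `W` applied to the Euler (dilation) generator
`weilDilationGenerator k (t) = t k'(t)`; we DEFINE

  `weilDilationVirial g := Re W(D(g ⋆ g̃))`,   `D = t d/dt`,

an explicit functional of `g` (no infimum is differentiated). Termwise (`weilDilationVirial_eq`;
`(Dk)(0) = 0`, so the `-k(0) log π` part of the archimedean term is `η`-invariant and drops out):
* polar: `Re((Dk)^(0) + (Dk)^(1))`, where `(Dk)^(s) = -k̂(s) - (s - 1/2) (t k)^(s)`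
  (`weilMellin_weilDilationGenerator`, one integration by parts);
* prime: `-Re Σₙ Λ(n) n^{-1/2} log n (k'(log n) - k'(-log n))`
  (`weilPrimeTerm_weilDilationGenerator`; a finite sum);
* archimedean: `(1/2π) Re ∫ (Dk)^(1/2 + iu) Re ψ(1/4 + iu/2) du`.

That this number IS the derivative, `HasDerivAt (fun η ↦ Re Q(weilDilate η g)) (weilDilationVirial g) 0`
for every test function `g`, is proved in the sibling file `WeilDilationVirialDeriv.lean`.
Bombieri (loc. cit.) uses only `lim_{ε→0} T[f_ε * f_ε*] = T[f * f*]`; the derivative is the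
"Hadamard variation" input of the window-flow route and is not in the printed source ([folklore]
calculus on the three explicit terms).

## Mathlib / tree search

No dilation operator on test functions or virial functional exists in Mathlib or in the tree
(`lean search 'weilDilat|Virial|dilation'`); the ingredients (`MeasureTheory.Measure.integral_comp_mul_left`,
`weilMellin`, `weilFunctional`) do.

## References

* E. Bombieri, *Remarks on Weil's quadratic functional in the theory of prime numbers I*, Atti
  Accad. Naz. Lincei Rend. Lincei (9) Mat. Appl. 11 (2000), 183–233, §4, proof of Theorem 5.
-/

noncomputable section

open Complex Filter Set MeasureTheory
open scoped Real Topology ComplexConjugate ContDiff ArithmeticFunction.vonMangoldt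

namespace Literature.NumberTheory.LFunctions

variable {g k : ℝ → ℂ}

/-! ## Rescaling `t ↦ k(c t)` -/

/-- Rescalings of test functions are test functions (`c ≠ 0`). [folklore] -/
theorem IsWeilTest.comp_mul (hk : IsWeilTest k) {c : ℝ} (hc : c ≠ 0) :
    IsWeilTest fun t ↦ k (c * t) := by
  refine ⟨hk.1.comp (contDiff_const.mul contDiff_id), ?_⟩
  have e : (fun t ↦ k (c * t)) = k ∘ Homeomorph.mulLeft₀ c hc := rfl
  rw [e]
  exact hk.2.comp_homeomorph _

/-- Support of a rescaling: if `tsupport k ⊆ [-a, a]` and `c > 0` then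
`tsupport (k(c ·)) ⊆ [-a/c, a/c]`. [folklore] -/
theorem tsupport_comp_mul_subset (k : ℝ → ℂ) {c a : ℝ} (hc : 0 < c)
    (h : tsupport k ⊆ Icc (-a) a) :
    tsupport (fun t ↦ k (c * t)) ⊆ Icc (-(a / c)) (a / c) := by
  intro x hx
  by_contra hxa
  have hopen : IsOpen ((fun t : ℝ ↦ c * t) ⁻¹' (Icc (-a) a)ᶜ) :=
    isClosed_Icc.isOpen_compl.preimage (continuous_const_mul c)
  have hxmem : x ∈ (fun t : ℝ ↦ c * t) ⁻¹' (Icc (-a) a)ᶜ := by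
    intro hcx
    apply hxa
    simp only [mem_Icc] at hcx ⊢
    constructor
    · rw [← neg_div, div_le_iff₀ hc]
      linarith [hcx.1, mul_comm c x]
    · rw [le_div_iff₀ hc]
      linarith [hcx.2, mul_comm c x]
  have hev : (fun t ↦ k (c * t)) =ᶠ[𝓝 x] 0 := by
    filter_upwards [hopen.mem_nhds hxmem] with t ht
    exact image_eq_zero_of_notMem_tsupport fun h' ↦ ht (h h')
  exact (notMem_tsupport_iff_eventuallyEq.2 hev) hx

/-- **Transform of a rescaling** (Bombieri 2000, proof of Thm 5:
`f̃_ε(s) = (1+ε)^{-1/2} f̃((s + ε/2)/(1+ε))`, here for the plain rescaling without the factor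
`(1+ε)^{1/2}`): for `c > 0`, `(k(c ·))^(s) = c⁻¹ k̂(1/2 + (s - 1/2)/c)` (substitute `y = c t`).
[cite: Bombieri2000Weil, §4 proof of Thm 5] -/
theorem weilMellin_comp_mul (k : ℝ → ℂ) {c : ℝ} (hc : 0 < c) (s : ℂ) :
    weilMellin (fun t ↦ k (c * t)) s = (c : ℂ)⁻¹ * weilMellin k (1 / 2 + (s - 1 / 2) / c) := by
  unfold weilMellin
  set G : ℝ → ℂ := fun y ↦ k y * cexp ((1 / 2 + (s - 1 / 2) / c - 1 / 2) * (y : ℂ)) with hG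
  have hc' : (c : ℂ) ≠ 0 := Complex.ofReal_ne_zero.2 hc.ne'
  have e : (fun t : ℝ ↦ k (c * t) * cexp ((s - 1 / 2) * (t : ℂ))) = fun t ↦ G (c * t) := by
    funext t
    simp only [hG, Complex.ofReal_mul]
    congr 2
    field_simp
    ring
  rw [e, Measure.integral_comp_mul_left G c, Complex.real_smul, abs_of_pos (inv_pos.2 hc),
    Complex.ofReal_inv]

/-! ## Bombieri's dilation `f_ε` in the additive variable -/

/-- **Bombieri's variation in the additive variable.** Bombieri (2000, §4, proof of Thm 5) varies
an extremal `f` of `T[f * f*]` on `L²([M⁻¹, M])` by `f_ε(x) = (1+ε)^{1/2} x^{ε/2} f(x^{1+ε})`; with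
`g(t) = e^{t/2} f(e^t)` (the dictionary of `WeilExplicit.lean`) this is
`g_η(t) = (1+η)^{1/2} g((1+η) t)`, the unitary dilation of `L²(ℝ)` compressing the window `[-a, a]`
to `[-a/(1+η), a/(1+η)]`. Meaningful for `η > -1`; for `η ≤ -1` the real square root makes it the
zero function (junk value, never used). [cite: Bombieri2000Weil, §4 proof of Thm 5] -/
def weilDilate (η : ℝ) (g : ℝ → ℂ) : ℝ → ℂ :=
  fun t ↦ (Real.sqrt (1 + η) : ℂ) * g ((1 + η) * t)

/-- Unfolding `weilDilate`. [folklore] -/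
theorem weilDilate_apply (η : ℝ) (g : ℝ → ℂ) (t : ℝ) :
    weilDilate η g t = (Real.sqrt (1 + η) : ℂ) * g ((1 + η) * t) :=
  rfl

/-- `η = 0` is the identity. [folklore] -/
@[simp] theorem weilDilate_zero (g : ℝ → ℂ) : weilDilate 0 g = g := by
  funext t
  simp [weilDilate]

/-- Dilates of test functions are test functions (`η > -1`). [folklore] -/
theorem IsWeilTest.weilDilate (hg : IsWeilTest g) {η : ℝ} (hη : -1 < η) :
    IsWeilTest (weilDilate η g) :=
  (hg.comp_mul (ne_of_gt (by linarith : (0 : ℝ) < 1 + η))).const_mul _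

/-- **The dilation is unitary**: `‖g_η‖₂² = ‖g‖₂²` for `η > -1` (Bombieri: "`f_ε` … has norm 1").
[cite: Bombieri2000Weil, §4 proof of Thm 5] -/
theorem integral_norm_sq_weilDilate (g : ℝ → ℂ) {η : ℝ} (hη : -1 < η) :
    ∫ t : ℝ, ‖weilDilate η g t‖ ^ 2 = ∫ t : ℝ, ‖g t‖ ^ 2 := by
  have hc : 0 < 1 + η := by linarith
  simp only [weilDilate, norm_mul, mul_pow, Complex.norm_real,
    Real.norm_of_nonneg (Real.sqrt_nonneg _), Real.sq_sqrt hc.le]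
  rw [integral_const_mul, Measure.integral_comp_mul_left (fun y : ℝ ↦ ‖g y‖ ^ 2) (1 + η),
    smul_eq_mul, abs_of_pos (inv_pos.2 hc), ← mul_assoc, mul_inv_cancel₀ hc.ne', one_mul]

/-- **The dilation compresses the window**: if `tsupport g ⊆ [-a, a]` and `η > -1` then
`tsupport g_η ⊆ [-a/(1+η), a/(1+η)]` (Bombieri: "`f_ε ∈ L²([M^{-1/(1+ε)}, M^{1/(1+ε)}])`").
[cite: Bombieri2000Weil, §4 proof of Thm 5] -/
theorem tsupport_weilDilate_subset (g : ℝ → ℂ) {η a : ℝ} (hη : -1 < η)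
    (h : tsupport g ⊆ Icc (-a) a) :
    tsupport (weilDilate η g) ⊆ Icc (-(a / (1 + η))) (a / (1 + η)) :=
  (tsupport_mul_subset_right (f := fun _ : ℝ ↦ (Real.sqrt (1 + η) : ℂ))
    (g := fun t ↦ g ((1 + η) * t))).trans (tsupport_comp_mul_subset g (by linarith) h)

/-- Transform of a dilate (Bombieri's `f̃_ε(s) = (1+ε)^{-1/2} f̃((s + ε/2)/(1+ε))`, and
`(s + ε/2)/(1+ε) = 1/2 + (s - 1/2)/(1+ε)`): `(g_η)^(s) = (1+η)^{1/2} (1+η)⁻¹ ĝ(1/2 + (s-1/2)/(1+η))`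
for `η > -1`. [cite: Bombieri2000Weil, §4 proof of Thm 5] -/
theorem weilMellin_weilDilate (g : ℝ → ℂ) {η : ℝ} (hη : -1 < η) (s : ℂ) :
    weilMellin (weilDilate η g) s =
      (Real.sqrt (1 + η) : ℂ) * ((1 + η : ℝ) : ℂ)⁻¹ *
        weilMellin g (1 / 2 + (s - 1 / 2) / ((1 + η : ℝ) : ℂ)) := by
  unfold weilDilate
  rw [weilMellin_const_mul, weilMellin_comp_mul g (by linarith : (0 : ℝ) < 1 + η), mul_assoc]

/-- **The autocorrelation of a dilate is the rescaled autocorrelation**, with NO prefactor: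
`(g_η ⋆ g̃_η)(t) = (g ⋆ g̃)((1+η) t)` for `η > -1` (substitute `y = (1+η) u` in the convolution
integral; the factor `1+η` from `(1+η)^{1/2} · (1+η)^{1/2}` cancels the Jacobian). [folklore] -/
theorem weilConv_weilDilate_weilReflect (g : ℝ → ℂ) {η : ℝ} (hη : -1 < η) :
    weilConv (weilDilate η g) (weilReflect (weilDilate η g)) =
      fun t ↦ weilConv g (weilReflect g) ((1 + η) * t) := by
  have hc : 0 < 1 + η := by linarith
  funext t
  rw [weilConv_apply, weilConv_apply]
  set G : ℝ → ℂ := fun y ↦ g y * weilReflect g ((1 + η) * t - y) with hG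
  have h2 : ((Real.sqrt (1 + η) : ℝ) : ℂ) * (Real.sqrt (1 + η) : ℂ) = ((1 + η : ℝ) : ℂ) := by
    rw [← Complex.ofReal_mul, Real.mul_self_sqrt hc.le]
  have e : (fun u : ℝ ↦ weilDilate η g u * weilReflect (weilDilate η g) (t - u)) =
      fun u ↦ ((1 + η : ℝ) : ℂ) * G ((1 + η) * u) := by
    funext u
    simp only [hG, weilDilate, weilReflect, map_mul, Complex.conj_ofReal]
    have h3 : (1 + η) * -(t - u) = -((1 + η) * t - (1 + η) * u) := by ring
    rw [h3]
    linear_combination (g ((1 + η) * u) * conj (g (-((1 + η) * t - (1 + η) * u)))) * h2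
  rw [e, integral_const_mul, Measure.integral_comp_mul_left G (1 + η), Complex.real_smul,
    abs_of_pos (inv_pos.2 hc), ← mul_assoc, ← Complex.ofReal_mul, mul_inv_cancel₀ hc.ne',
    Complex.ofReal_one, one_mul]

/-- Hence **`Q(g_η) = W(k((1+η)·))`** with `k = g ⋆ g̃`, for `η > -1`. [folklore] -/
theorem weilQuadratic_weilDilate (g : ℝ → ℂ) {η : ℝ} (hη : -1 < η) :
    weilQuadratic (weilDilate η g) =
      weilFunctional (fun t ↦ weilConv g (weilReflect g) ((1 + η) * t)) := by
  rw [weilQuadratic, weilConv_weilDilate_weilReflect g hη]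

/-! ## The Euler generator `D = t d/dt` -/

/-- The Euler (dilation) generator `(Dk)(t) = t k'(t)`: `d/dη|₀ k((1+η) t) = t k'(t)`, i.e. the
infinitesimal generator of the rescaling group `k ↦ k(c ·)` at `c = 1`. [folklore] -/
def weilDilationGenerator (k : ℝ → ℂ) : ℝ → ℂ :=
  fun t ↦ (t : ℂ) * deriv k t

/-- Unfolding `weilDilationGenerator`. [folklore] -/
theorem weilDilationGenerator_apply (k : ℝ → ℂ) (t : ℝ) :
    weilDilationGenerator k t = (t : ℂ) * deriv k t :=
  rfl

/-- `(Dk)(0) = 0`: the generator kills the value at the origin (so `k_η(0) = k(0)` is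
`η`-invariant to first order — in fact exactly). [folklore] -/
@[simp] theorem weilDilationGenerator_apply_zero (k : ℝ → ℂ) : weilDilationGenerator k 0 = 0 := by
  simp [weilDilationGenerator]

/-- `t ↦ t k(t)` is a test function when `k` is. [folklore] -/
theorem IsWeilTest.ofReal_mul (hk : IsWeilTest k) : IsWeilTest fun t : ℝ ↦ (t : ℂ) * k t :=
  ⟨Complex.ofRealCLM.contDiff.mul hk.1, hk.2.mul_left⟩

/-- `Dk` is a test function when `k` is. [folklore] -/
theorem IsWeilTest.weilDilationGenerator (hk : IsWeilTest k) :
    IsWeilTest (weilDilationGenerator k) :=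
  hk.deriv.ofReal_mul

/-- **`D` generates the rescalings**: `d/dη k((1+η) t) = t k'((1+η) t)` at every `η`, for a test
function `k` (chain rule). [folklore] -/
theorem hasDerivAt_comp_one_add_mul (hk : IsWeilTest k) (t η : ℝ) :
    HasDerivAt (fun η : ℝ ↦ k ((1 + η) * t)) ((t : ℂ) * deriv k ((1 + η) * t)) η := by
  have h1 : HasDerivAt (fun η : ℝ ↦ (1 + η) * t) t η := by
    simpa using ((hasDerivAt_id η).const_add 1).mul_const t
  have h2 : HasDerivAt k (deriv k ((1 + η) * t)) ((1 + η) * t) :=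
    (hk.1.differentiable (by simp) _).hasDerivAt
  have h := h2.scomp η h1
  simpa [Function.comp_def, Complex.real_smul] using h

/-- At `η = 0`: `d/dη|₀ k((1+η) t) = (Dk)(t)`. [folklore] -/
theorem hasDerivAt_comp_one_add_mul_zero (hk : IsWeilTest k) (t : ℝ) :
    HasDerivAt (fun η : ℝ ↦ k ((1 + η) * t)) (weilDilationGenerator k t) 0 := by
  simpa [weilDilationGenerator] using hasDerivAt_comp_one_add_mul hk t 0

/-- `(t k(t))' = k(t) + t k'(t)`. [folklore] -/
theorem deriv_ofReal_mul (hk : IsWeilTest k) :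
    deriv (fun t : ℝ ↦ (t : ℂ) * k t) = fun t ↦ k t + weilDilationGenerator k t := by
  funext t
  have h1 : HasDerivAt (fun t : ℝ ↦ (t : ℂ)) 1 t := by
    simpa using (hasDerivAt_id t).ofReal_comp
  have h2 : HasDerivAt k (deriv k t) t := (hk.1.differentiable (by simp) t).hasDerivAt
  have h3 : HasDerivAt (fun t : ℝ ↦ (t : ℂ) * k t) (1 * k t + (t : ℂ) * deriv k t) t := h1.mul h2
  rw [h3.deriv, weilDilationGenerator_apply, one_mul]

/-- **Transform of the generator** (one integration by parts, `weilMellin_deriv` applied to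
`t k(t)`): `(Dk)^(s) = -k̂(s) - (s - 1/2) (t k)^(s)`. Since `(t k)^ = (k̂)'` this is
`(Dk)^ = -(d/ds)((s - 1/2) k̂(s))`, the Mellin shadow of `d/dη|₀ [(1+η)⁻¹ k̂(1/2 + (s-1/2)/(1+η))]`.
[folklore] -/
theorem weilMellin_weilDilationGenerator (hk : IsWeilTest k) (s : ℂ) :
    weilMellin (weilDilationGenerator k) s =
      -weilMellin k s - (s - 1 / 2) * weilMellin (fun t : ℝ ↦ (t : ℂ) * k t) s := by
  have hm : IsWeilTest fun t : ℝ ↦ (t : ℂ) * k t := hk.ofReal_mul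
  have hD : IsWeilTest (weilDilationGenerator k) := hk.weilDilationGenerator
  have h := weilMellin_deriv hm s
  rw [deriv_ofReal_mul hk] at h
  have hadd := weilMellin_add hk.1.continuous hk.2 hD.1.continuous hD.2 s
  rw [show k + weilDilationGenerator k = fun t ↦ k t + weilDilationGenerator k t from rfl] at hadd
  linear_combination h - hadd

/-- The prime term of `Dk` in explicit form:
`Σₙ Λ(n) n^{-1/2} ((Dk)(log n) + (Dk)(-log n)) = Σₙ Λ(n) n^{-1/2} log n (k'(log n) - k'(-log n))`.
For `k = g ⋆ g̃` one has `k'(-t) = -conj k'(t)`, so the summand is `2 Λ(n) n^{-1/2} log n · Re k'(log n)`.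
[folklore] -/
theorem weilPrimeTerm_weilDilationGenerator (k : ℝ → ℂ) :
    weilPrimeTerm (weilDilationGenerator k) =
      ∑' n : ℕ, ((Λ n : ℝ) : ℂ) / (Real.sqrt n : ℂ) *
        ((Real.log n : ℂ) * (deriv k (Real.log n) - deriv k (-Real.log n))) := by
  unfold weilPrimeTerm weilDilationGenerator
  congr 1 with n
  push_cast
  ring

/-! ## The virial -/

/-- **The dilation virial of Weil's quadratic functional** at a test function `g`:
`weilDilationVirial g := Re W(D(g ⋆ g̃))`, `D = t d/dt`, i.e. the Weil functional
`W = weilFunctional` evaluated at the Euler generator applied to the autocorrelation `k = g ⋆ g̃`.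
It is the first-order change of `Q(g) = W(g ⋆ g̃)` under Bombieri's window-compressing dilation
`g_η(t) = (1+η)^{1/2} g((1+η)t)` (`weilDilate`; Bombieri 2000, §4, proof of Thm 5,
`f_ε(x) = (1+ε)^{1/2} x^{ε/2} f(x^{1+ε})`): `(g_η ⋆ g̃_η)(t) = k((1+η)t)`, `W` is linear, and
`d/dη|₀ k((1+η)t) = (Dk)(t)`; the theorem
`HasDerivAt (fun η ↦ Re Q(g_η)) (weilDilationVirial g) 0` is `hasDerivAt_re_weilQuadratic_weilDilate`
(`WeilDilationVirialDeriv.lean`). Termwise (`weilDilationVirial_eq`): polar `Re((Dk)^(0) + (Dk)^(1))`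
with `(Dk)^(s) = -k̂(s) - (s-1/2)(t k)^(s)`; prime `-Re Σₙ Λ(n) n^{-1/2} log n (k'(log n) - k'(-log n))`;
archimedean `(1/2π) Re ∫ (Dk)^(1/2+iu) Re ψ(1/4+iu/2) du` (the `-k(0) log π` term is `η`-invariant,
`(Dk)(0) = 0`). The derivative itself is not printed by Bombieri (who uses only
`T[f_ε * f_ε*] → T[f * f*]`); it is the Hadamard-variation input of route `WeilWindowFlow`.
[folklore] -/
def weilDilationVirial (g : ℝ → ℂ) : ℝ :=
  (weilFunctional (weilDilationGenerator (weilConv g (weilReflect g)))).re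

/-- Unfolding `weilDilationVirial`. [folklore] -/
theorem weilDilationVirial_def (g : ℝ → ℂ) :
    weilDilationVirial g =
      (weilFunctional (weilDilationGenerator (weilConv g (weilReflect g)))).re :=
  rfl

/-- **The virial termwise**: with `k = g ⋆ g̃`,
`weilDilationVirial g = Re[(Dk)^(0) + (Dk)^(1)] - Re Σₙ Λ(n) n^{-1/2}((Dk)(log n) + (Dk)(-log n))
  + (1/2π) Re ∫ (Dk)^(1/2+iu) Re ψ(1/4+iu/2) du`
— the `-(Dk)(0) log π` part of `W_∞(Dk)` vanishes because `(Dk)(0) = 0`. [folklore] -/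
theorem weilDilationVirial_eq (g : ℝ → ℂ) :
    weilDilationVirial g =
      (weilPolarTerm (weilDilationGenerator (weilConv g (weilReflect g)))).re
        - (weilPrimeTerm (weilDilationGenerator (weilConv g (weilReflect g)))).re
        + 1 / (2 * π) *
          (weilArchIntegral (weilDilationGenerator (weilConv g (weilReflect g)))).re := by
  have hc : (1 / (2 * π) : ℂ) = ((1 / (2 * π) : ℝ) : ℂ) := by push_cast; ring
  simp only [weilDilationVirial, weilFunctional, weilArchTerm, weilDilationGenerator_apply_zero,
    zero_mul, sub_zero, Complex.add_re, Complex.sub_re, hc, Complex.re_ofReal_mul]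

end Literature.NumberTheory.LFunctions

end
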